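import Summits.MatrixMultiplication.OmegaCensus.AtomBadAll
import Summits.MatrixMultiplication.OmegaCensus.BoxBadSimplePrimeFive
import Summits.MatrixMultiplication.OmegaCensus.BoxUsefulCoord2

/-!
# ω-census, family (b3): conjecture C9 (b) — `BoxRatioSectionLaw` HOLDS for every finite group

HONEST FRAMING (pub-omega census; verbatim): lottery ticket; floor = certified bounds/negative ranges.
Census BOOKKEEPING (conjecture C9 of the cell, STRUCTURE.md §2, registered 2026-08-25; pub-omega stpp-1 gen 23 with kernel-l4 gen 18).
Nothing here is progress on `ω`.

**Theorem (`boxRatioSectionLaw`).**  A box-useful finite group — one all of whose `3 × 3`-column boxes `G × Y × W` have independent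
cell sets of fewer than `(9/5)|G|` cells, `BoxUseful` — is abelian, or has centre of index `4` or `6`, or carries the `𝒞₂` coordinate
package `DihC3Sq.Coord2` (`C₃² ⋊_ε C`, `C` abelian acting through `±1`).  This is the cell's conjecture C9 (b) (`BoxRatioSectionLaw`,
file `BoxRatioSectionLaw`), now a theorem for EVERY finite group: the atom hypothesis (A) is kernel-l4's `atomBad_of_five_le`
(`AtomBadAll`: every `A(p,q)`-configuration with `p ≠ q` primes, `q ≥ 5`, kills box-usefulness — coset patterns, uniformly in `p, q`),
and the simple-group hypothesis (S) is `not_boxUseful_simple_of_atomBad_five` (`BoxBadSimplePrimeFive`: abelian Sylow subgroups for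
`p ≥ 5`, Burnside's normal `p`-complement theorem, coprime action and the trace lemma give an atom configuration inside any non-abelian
simple group with a prime `≥ 5`; `{2,3}`-groups are solvable by the tree's Burnside `p^a q^b` theorem).  Assembly:
`boxRatioSectionLaw_of_atomBad_five`.  With the converse `BoxUseful.of_classes` (`BoxUsefulCoord2`: each of the four classes IS
box-useful) this is an EXACT CHARACTERISATION, `boxUseful_iff_lawful`.  Consequence for the census of two-`3`-set TPP triples (Neumann's bound): the only finite groups
`G` with `α(G;|G|,3,3) < (9/5)|G|` are those four classes, on which `r(G) ∈ {1, 3/2, 5/3, 16/9}` (C9 (c), kernel rows R311 / NR154 /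
P-031.3b).  Also recorded: `not_boxUseful_of_not_isSolvable'` — every finite NON-SOLVABLE group is box-useless (classification-free) — and
`isSolvable_of_boxUseful`.
-/

namespace Summit.MatrixMultiplication.OmegaCensus

/-- **C9 (b) — the box-ratio section law — holds for every finite group**: a box-useful finite group has centre of index `1`, `4`
or `6`, or carries the `𝒞₂` package. [folklore] -/
theorem boxRatioSectionLaw : BoxRatioSectionLaw :=
  boxRatioSectionLaw_of_atomBad_five fun _ _ hp hq hpq h5 => atomBad_of_five_le hp hq hpq h5

/-- Pointwise form: a box-useful finite group `G` is abelian, has `[G : Z(G)] ∈ {4, 6}`, or carries `DihC3Sq.Coord2`. [folklore] -/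
theorem lawful_of_boxUseful (G : Type) [Group G] [Fintype G] [DecidableEq G] (hG : BoxUseful G) :
    (Subgroup.center G).index = 1 ∨ (Subgroup.center G).index = 4 ∨ (Subgroup.center G).index = 6 ∨
      ∃ (c₁ c₂ : G) (κ₁ κ₂ ε : G → ZMod 3), DihC3Sq.Coord2 c₁ c₂ κ₁ κ₂ ε :=
  boxRatioSectionLaw G hG

/-- **C9 (b) + (c): exact characterisation.**  A finite group is box-useful iff it is abelian, or has centre of index `4` or `6`,
or carries the `𝒞₂` package (`boxRatioSectionLaw` + `BoxUseful.of_classes`). [folklore] -/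
theorem boxUseful_iff_lawful (G : Type) [Group G] [Fintype G] [DecidableEq G] :
    BoxUseful G ↔ ((Subgroup.center G).index = 1 ∨ (Subgroup.center G).index = 4 ∨ (Subgroup.center G).index = 6 ∨
      ∃ (c₁ c₂ : G) (κ₁ κ₂ ε : G → ZMod 3), DihC3Sq.Coord2 c₁ c₂ κ₁ κ₂ ε) :=
  ⟨boxRatioSectionLaw G, BoxUseful.of_classes⟩

/-- Contrapositive form for the census: a finite group whose centre has index `∉ {1, 4, 6}` and which carries no `𝒞₂` package is
NOT box-useful — some `3 × 3`-column box has an independent cell set of at least `(9/5)|G|` cells. [folklore] -/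
theorem not_boxUseful_of_not_lawful (G : Type) [Group G] [Fintype G] [DecidableEq G]
    (h1 : (Subgroup.center G).index ≠ 1) (h4 : (Subgroup.center G).index ≠ 4) (h6 : (Subgroup.center G).index ≠ 6)
    (hC : ¬ ∃ (c₁ c₂ : G) (κ₁ κ₂ ε : G → ZMod 3), DihC3Sq.Coord2 c₁ c₂ κ₁ κ₂ ε) : ¬ BoxUseful G := fun hG => by
  rcases boxRatioSectionLaw G hG with h | h | h | h
  · exact h1 h
  · exact h4 h
  · exact h6 h
  · exact hC h

/-- **Every finite non-solvable group is box-useless** (classification-free): `not_boxUseful_of_not_isSolvable` (reduction to simple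
sections, C9 (a)) with (S) = `not_boxUseful_simple_of_atomBad_five` and (A) = `atomBad_of_five_le`. [folklore] -/
theorem not_boxUseful_of_not_isSolvable' (G : Type) [Group G] [Fintype G] [DecidableEq G] (hG : ¬ IsSolvable G) :
    ¬ BoxUseful G :=
  not_boxUseful_of_not_isSolvable
    (fun S _ _ _ hS hna => not_boxUseful_simple_of_atomBad_five (fun _ _ hp hq hpq h5 => atomBad_of_five_le hp hq hpq h5) S hS hna)
    (Fintype.card G) G rfl hG

/-- Hence a box-useful finite group is solvable. [folklore] -/
theorem isSolvable_of_boxUseful (G : Type) [Group G] [Fintype G] [DecidableEq G] (hG : BoxUseful G) : IsSolvable G := by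
  by_contra h
  exact not_boxUseful_of_not_isSolvable' G h hG

end Summit.MatrixMultiplication.OmegaCensus
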